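import Literature.RepresentationTheory.Semisimple.Multiplicity
import Mathlib.LinearAlgebra.Charpoly.ToMatrix
import Mathlib.LinearAlgebra.Matrix.Block
import Mathlib.LinearAlgebra.Matrix.GeneralLinearGroup.Defs
import Mathlib.LinearAlgebra.Matrix.Reindex
import Mathlib.LinearAlgebra.Matrix.ToLin
import Mathlib.LinearAlgebra.FiniteDimensional.Lemmas
import HarnessLib

/-!
# Semisimplification of matrix representations `G → GL_n(k)` in every rank

For a group homomorphism `ψ : G → GL_n(k)` over a field `k`, a **semisimplification**: a
homomorphism `ψ' : G → GL_n(k)` whose representation on `kⁿ` is semisimple, with the same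
characteristic polynomials `det(X - ψ'(g)) = det(X - ψ(g))` for all `g`, and `ker ψ ≤ ker ψ'`.
This is the general-rank version of the accepted rank-two
`Literature.RepresentationTheory.Semisimple.exists_semisimplification_fin_two`
(`FinTwoSemisimplification.lean`), by the classical Jordan–Hölder/dévissage argument
(Curtis–Reiner, *Methods of Representation Theory* I, §16B; Bourbaki, *Algèbre* VIII § 20 n° 6,
"semi-simplifié"; used for residual Galois representations in Deligne–Serre 1974, 6.12 and
Darmon–Diamond–Taylor 1995, §2.1): by strong induction on `n`, either `kⁿ` is already
semisimple, or it has a proper non-zero stable subspace `W`; in a basis adapted to a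
decomposition `kⁿ = W ⊕ C` the matrices are block upper triangular
`(A(g) B(g); 0 D(g))`, `A` and `D` are homomorphisms into `GL_m`, `GL_{n-m}` with
`charpoly ψ(g) = charpoly A(g) · charpoly D(g)` (Mathlib `Matrix.charpoly_fromBlocks_zero₂₁`),
and the block-diagonal sum of semisimplifications of `A` and `D` (semisimple as a direct sum,
`Representation.isSemisimpleRepresentation_prod` of `Multiplicity.lean`) is a semisimplification
of `ψ`.  Everything is PROVED; no definitions.

* `Literature.RepresentationTheory.Semisimple.exists_semisimplification` — the theorem, in the
  shape of `exists_semisimplification_fin_two`.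

## References

* C. W. Curtis, I. Reiner, *Methods of Representation Theory* I, Wiley (1981), §16B.
* N. Bourbaki, *Algèbre*, Ch. VIII (2012), § 20 n° 6. [BourbakiAlgebreVIII2012]
* P. Deligne, J.-P. Serre, *Formes modulaires de poids 1*, ASENS 7 (1974), 6.12. [DeligneSerreASENS1974]
-/

noncomputable section

open scoped MatrixGroups

open Matrix Module

namespace Literature.RepresentationTheory.Semisimple

universe u v

variable {k : Type u} [Field k] {G : Type v} [Group G]

/-! ### Block-diagonal homomorphisms -/

/-- The block-diagonal sum of two `GL`-valued homomorphisms, reindexed along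
`e : Fin m ⊕ Fin p ≃ Fin n`, as a homomorphism `G → GL_n(k)`; stated as an existence with its
defining matrix identity (this proof file declares no definitions). [folklore] -/
theorem exists_blockDiag_hom {m p n : ℕ} (e : Fin m ⊕ Fin p ≃ Fin n) (A : G →* GL (Fin m) k)
    (D : G →* GL (Fin p) k) :
    ∃ ψ : G →* GL (Fin n) k, ∀ g, ((ψ g : GL (Fin n) k) : Matrix (Fin n) (Fin n) k) =
      Matrix.reindex e e (Matrix.fromBlocks ((A g : GL (Fin m) k) : Matrix (Fin m) (Fin m) k) 0 0
        ((D g : GL (Fin p) k) : Matrix (Fin p) (Fin p) k)) := by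
  classical
  let N : G → Matrix (Fin m ⊕ Fin p) (Fin m ⊕ Fin p) k := fun g ↦
    Matrix.fromBlocks ((A g : GL (Fin m) k) : Matrix (Fin m) (Fin m) k) 0 0
      ((D g : GL (Fin p) k) : Matrix (Fin p) (Fin p) k)
  have hN_mul : ∀ g h, N (g * h) = N g * N h := fun g h ↦ by
    simp only [N, map_mul, Units.val_mul, Matrix.fromBlocks_multiply, Matrix.mul_zero,
      Matrix.zero_mul, add_zero, zero_add]
  have hN_one : N 1 = 1 := by
    simp only [N, map_one, Units.val_one, Matrix.fromBlocks_one]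
  let N' : G → Matrix (Fin n) (Fin n) k := fun g ↦ Matrix.reindex e e (N g)
  have hN'_mul : ∀ g h, N' (g * h) = N' g * N' h := fun g h ↦ by
    simp only [N', hN_mul]
    exact (Matrix.reindexLinearEquiv_mul k k e e e (N g) (N h)).symm
  have hN'_one : N' 1 = 1 := by
    simp only [N', hN_one, Matrix.reindex_apply, Matrix.submatrix_one_equiv]
  refine ⟨{ toFun := fun g ↦ ⟨N' g, N' g⁻¹, by rw [← hN'_mul, mul_inv_cancel, hN'_one],
      by rw [← hN'_mul, inv_mul_cancel, hN'_one]⟩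
            map_one' := Units.ext hN'_one
            map_mul' := fun g h ↦ Units.ext (hN'_mul g h) }, fun g ↦ rfl⟩


/-- The representation on `kⁿ` through a block-diagonal homomorphism is equivalent to the direct
sum (Mathlib `Representation.prod`) of the representations through the blocks, hence is
**semisimple when the blocks are** (`Representation.isSemisimpleRepresentation_prod`,
`Multiplicity.lean`). [folklore] -/
theorem isSemisimpleRepresentation_of_blockDiag {m p n : ℕ} (e : Fin m ⊕ Fin p ≃ Fin n)
    {A : G →* GL (Fin m) k} {D : G →* GL (Fin p) k} {ψ : G →* GL (Fin n) k}
    (hψ : ∀ g, ((ψ g : GL (Fin n) k) : Matrix (Fin n) (Fin n) k) =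
      Matrix.reindex e e (Matrix.fromBlocks ((A g : GL (Fin m) k) : Matrix (Fin m) (Fin m) k) 0 0
        ((D g : GL (Fin p) k) : Matrix (Fin p) (Fin p) k)))
    (hA : Representation.IsSemisimpleRepresentation
      ((Representation.ofDistribMulAction k (GL (Fin m) k) (Fin m → k)).comp A))
    (hD : Representation.IsSemisimpleRepresentation
      ((Representation.ofDistribMulAction k (GL (Fin p) k) (Fin p → k)).comp D)) :
    Representation.IsSemisimpleRepresentation
      ((Representation.ofDistribMulAction k (GL (Fin n) k) (Fin n → k)).comp ψ) := by
  classical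
  set ρA : Representation k G (Fin m → k) :=
    (Representation.ofDistribMulAction k (GL (Fin m) k) (Fin m → k)).comp A
  set ρD : Representation k G (Fin p → k) :=
    (Representation.ofDistribMulAction k (GL (Fin p) k) (Fin p → k)).comp D
  set ρ : Representation k G (Fin n → k) :=
    (Representation.ofDistribMulAction k (GL (Fin n) k) (Fin n → k)).comp ψ
  haveI : ρA.IsSemisimpleRepresentation := hA
  haveI : ρD.IsSemisimpleRepresentation := hD
  -- the comparison isomorphism `(x, y) ↦ (Sum.elim x y) ∘ e⁻¹`
  let E : ((Fin m → k) × (Fin p → k)) ≃ₗ[k] (Fin n → k) :=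
    (LinearEquiv.sumArrowLequivProdArrow (Fin m) (Fin p) k k).symm ≪≫ₗ
      LinearEquiv.funCongrLeft k k e.symm
  have hsum : ∀ (x : Fin m → k) (y : Fin p → k) (s : Fin m ⊕ Fin p),
      (LinearEquiv.sumArrowLequivProdArrow (Fin m) (Fin p) k k).symm (x, y) s = Sum.elim x y s := by
    rintro x y (j | j) <;> simp
  have hE : ∀ (x : Fin m → k) (y : Fin p → k) (i : Fin n), E (x, y) i = Sum.elim x y (e.symm i) := by
    intro x y i
    simp only [E, LinearEquiv.trans_apply, LinearEquiv.funCongrLeft_apply, LinearMap.funLeft_apply,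
      hsum]
  have hequiv : (ρA.prod ρD).Equiv ρ := by
    refine Representation.Equiv.mk E fun g ↦ LinearMap.ext fun xy ↦ ?_
    obtain ⟨x, y⟩ := xy
    change E (((A g : GL (Fin m) k) : Matrix (Fin m) (Fin m) k) *ᵥ x,
        ((D g : GL (Fin p) k) : Matrix (Fin p) (Fin p) k) *ᵥ y) =
      ((ψ g : GL (Fin n) k) : Matrix (Fin n) (Fin n) k) *ᵥ E (x, y)
    have hExy : E (x, y) = Sum.elim x y ∘ e.symm := funext (hE x y)
    rw [hExy, hψ g, Matrix.reindex_apply, Matrix.submatrix_mulVec_equiv]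
    funext i
    rw [hE]
    simp only [Function.comp_apply, Equiv.symm_symm]
    rw [show (Sum.elim x y ∘ ⇑e.symm) ∘ ⇑e = Sum.elim x y from by
      funext j; simp, Matrix.fromBlocks_mulVec]
    simp
  exact Representation.isSemisimpleRepresentation_of_equiv hequiv


/-! ### Dévissage: block upper triangular form along a stable subspace -/

/-- **Dévissage step.**  If the representation of `G` on `kⁿ` through `ψ : G →* GL_n(k)` has a
proper non-zero subrepresentation `W`, then in a basis adapted to a decomposition `kⁿ = W ⊕ C`
the matrices of `ψ` are block upper triangular; the diagonal blocks are homomorphisms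
`A : G →* GL_m(k)` (`m = dim W`), `D : G →* GL_p(k)` (`p = n - m`), with `0 < m, p < n`,
`det(X - ψ(g)) = det(X - A(g)) · det(X - D(g))` (Mathlib `Matrix.charpoly_fromBlocks_zero₂₁`) and
`ker ψ ≤ ker A ⊓ ker D`.  Curtis–Reiner, *Methods* I, §16B. [folklore] -/
theorem exists_blocks_of_subrepresentation {n : ℕ} (ψ : G →* GL (Fin n) k)
    (W : Subrepresentation ((Representation.ofDistribMulAction k (GL (Fin n) k) (Fin n → k)).comp ψ))
    (hW0 : W ≠ ⊥) (hW1 : W ≠ ⊤) :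
    ∃ (m p : ℕ) (_ : m < n) (_ : p < n) (_ : Fin m ⊕ Fin p ≃ Fin n) (A : G →* GL (Fin m) k)
      (D : G →* GL (Fin p) k),
      (∀ g, ((ψ g : GL (Fin n) k) : Matrix (Fin n) (Fin n) k).charpoly =
        ((A g : GL (Fin m) k) : Matrix (Fin m) (Fin m) k).charpoly *
          ((D g : GL (Fin p) k) : Matrix (Fin p) (Fin p) k).charpoly) ∧
      ψ.ker ≤ A.ker ∧ ψ.ker ≤ D.ker := by
  classical
  -- the representation `R` on `kⁿ` (kept as the literal composite, of which `W` is a subrepresentation)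
  have hRapply : ∀ (g : G) (v : Fin n → k),
      ((Representation.ofDistribMulAction k (GL (Fin n) k) (Fin n → k)).comp ψ) g v =
        ((ψ g : GL (Fin n) k) : Matrix (Fin n) (Fin n) k) *ᵥ v := fun _ _ ↦ rfl
  have hRlin : ∀ g,
      (((Representation.ofDistribMulAction k (GL (Fin n) k) (Fin n → k)).comp ψ) g :
        (Fin n → k) →ₗ[k] (Fin n → k)) =
      Matrix.toLin' ((ψ g : GL (Fin n) k) : Matrix (Fin n) (Fin n) k) := fun g ↦
    LinearMap.ext fun v ↦ by rw [Matrix.toLin'_apply, hRapply]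
  -- the stable subspace `W` and a complement `C`
  have hbot : (⊥ : Subrepresentation
      ((Representation.ofDistribMulAction k (GL (Fin n) k) (Fin n → k)).comp ψ)).toSubmodule = ⊥ :=
    rfl
  have htop : (⊤ : Subrepresentation
      ((Representation.ofDistribMulAction k (GL (Fin n) k) (Fin n → k)).comp ψ)).toSubmodule = ⊤ :=
    rfl
  have hWS0 : W.toSubmodule ≠ ⊥ := fun h ↦
    hW0 (Subrepresentation.toSubmodule_injective (h.trans hbot.symm))
  have hWS1 : W.toSubmodule ≠ ⊤ := fun h ↦
    hW1 (Subrepresentation.toSubmodule_injective (h.trans htop.symm))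
  obtain ⟨C, hWC⟩ := Submodule.exists_isCompl W.toSubmodule
  obtain ⟨m, hm⟩ : ∃ m, finrank k W.toSubmodule = m := ⟨_, rfl⟩
  obtain ⟨p, hp⟩ : ∃ p, finrank k C = p := ⟨_, rfl⟩
  have hmp : m + p = n := by
    rw [← hm, ← hp, Submodule.finrank_add_eq_of_isCompl hWC, Module.finrank_fin_fun]
  have hm0 : 0 < m := by
    refine Nat.pos_of_ne_zero fun h ↦ hWS0 ?_
    exact Submodule.finrank_eq_zero.mp (hm.trans h)
  have hp0 : 0 < p := by
    refine Nat.pos_of_ne_zero fun h ↦ hWS1 ?_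
    have hC : C = ⊥ := Submodule.finrank_eq_zero.mp (hp.trans h)
    have := hWC.sup_eq_top
    rwa [hC, sup_bot_eq] at this
  have hmn : m < n := by omega
  have hpn : p < n := by omega
  -- an adapted basis `b`
  let bW : Basis (Fin m) k W.toSubmodule := Module.finBasisOfFinrankEq k W.toSubmodule hm
  let bC : Basis (Fin p) k C := Module.finBasisOfFinrankEq k C hp
  let f : (W.toSubmodule × C) ≃ₗ[k] (Fin n → k) := Submodule.prodEquivOfIsCompl W.toSubmodule C hWC
  let b : Basis (Fin m ⊕ Fin p) k (Fin n → k) := (bW.prod bC).map f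
  have hrepr : ∀ w : Fin n → k, w ∈ W.toSubmodule → ∀ i : Fin p, b.repr w (Sum.inr i) = 0 := by
    intro w hw i
    have h1 : b.repr w = (bW.prod bC).repr (f.symm w) := by
      simp only [b, Module.Basis.map_repr, LinearEquiv.trans_apply]
    have h2 : f.symm w = ((⟨w, hw⟩ : W.toSubmodule), 0) :=
      Submodule.prodEquivOfIsCompl_symm_apply_left (p := W.toSubmodule) (q := C) hWC
        (⟨w, hw⟩ : W.toSubmodule)
    rw [h1, h2, Module.Basis.prod_repr_inr]
    simp
  have hb_inl : ∀ j : Fin m, (b (Sum.inl j) : Fin n → k) ∈ W.toSubmodule := by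
    intro j
    have : b (Sum.inl j) = f ((bW.prod bC) (Sum.inl j)) := by simp [b]
    rw [this, Submodule.coe_prodEquivOfIsCompl', Module.Basis.prod_apply_inl_fst,
      Module.Basis.prod_apply_inl_snd]
    simp
  -- matrices in the adapted basis
  let M : G → Matrix (Fin m ⊕ Fin p) (Fin m ⊕ Fin p) k := fun g ↦
    LinearMap.toMatrix b b (((Representation.ofDistribMulAction k (GL (Fin n) k) (Fin n → k)).comp ψ) g)
  have hM_mul : ∀ g h, M (g * h) = M g * M h := fun g h ↦ by
    simp only [M, map_mul]
    exact LinearMap.toMatrix_mul b _ _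
  have hM_one : M 1 = 1 := by
    simp only [M, map_one]
    exact LinearMap.toMatrix_one b
  have hM_charpoly : ∀ g, (M g).charpoly = ((ψ g : GL (Fin n) k) : Matrix (Fin n) (Fin n) k).charpoly :=
    fun g ↦ by
      simp only [M]
      rw [LinearMap.charpoly_toMatrix, hRlin, Matrix.charpoly_toLin']
  have h21 : ∀ g, (M g).toBlocks₂₁ = 0 := by
    intro g
    ext i j
    change M g (Sum.inr i) (Sum.inl j) = 0
    simp only [M, LinearMap.toMatrix_apply]
    exact hrepr _ (W.apply_mem_toSubmodule g (hb_inl j)) i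
  -- the diagonal blocks are multiplicative
  let A₀ : G → Matrix (Fin m) (Fin m) k := fun g ↦ (M g).toBlocks₁₁
  let B₀ : G → Matrix (Fin m) (Fin p) k := fun g ↦ (M g).toBlocks₁₂
  let D₀ : G → Matrix (Fin p) (Fin p) k := fun g ↦ (M g).toBlocks₂₂
  have hblock : ∀ g, M g = Matrix.fromBlocks (A₀ g) (B₀ g) 0 (D₀ g) := fun g ↦ by
    conv_lhs => rw [← Matrix.fromBlocks_toBlocks (M g), h21 g]
  have hmul : ∀ g h, A₀ (g * h) = A₀ g * A₀ h ∧ D₀ (g * h) = D₀ g * D₀ h := by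
    intro g h
    have e1 := hM_mul g h
    rw [hblock, hblock, hblock, Matrix.fromBlocks_multiply] at e1
    obtain ⟨hA, -, -, hD⟩ := Matrix.fromBlocks_inj.mp e1
    refine ⟨?_, ?_⟩
    · rw [hA, Matrix.mul_zero, add_zero]
    · rw [hD, Matrix.zero_mul, zero_add]
  have hone : A₀ 1 = 1 ∧ D₀ 1 = 1 := by
    have e1 := hM_one
    rw [hblock, ← Matrix.fromBlocks_one] at e1
    obtain ⟨hA, -, -, hD⟩ := Matrix.fromBlocks_inj.mp e1
    exact ⟨hA, hD⟩
  have hker : ∀ g, ψ g = 1 → A₀ g = 1 ∧ D₀ g = 1 := by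
    intro g hg
    have hRg : ((Representation.ofDistribMulAction k (GL (Fin n) k) (Fin n → k)).comp ψ) g = 1 := by
      rw [MonoidHom.comp_apply, hg, map_one]
    have e1 : M g = 1 := by simp only [M, hRg]; exact LinearMap.toMatrix_one b
    rw [hblock, ← Matrix.fromBlocks_one] at e1
    obtain ⟨hA, -, -, hD⟩ := Matrix.fromBlocks_inj.mp e1
    exact ⟨hA, hD⟩
  -- as homomorphisms into `GL`
  let A : G →* GL (Fin m) k :=
    { toFun := fun g ↦ ⟨A₀ g, A₀ g⁻¹, by rw [← (hmul _ _).1, mul_inv_cancel, hone.1],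
        by rw [← (hmul _ _).1, inv_mul_cancel, hone.1]⟩
      map_one' := Units.ext hone.1
      map_mul' := fun g h ↦ Units.ext (hmul g h).1 }
  let D : G →* GL (Fin p) k :=
    { toFun := fun g ↦ ⟨D₀ g, D₀ g⁻¹, by rw [← (hmul _ _).2, mul_inv_cancel, hone.2],
        by rw [← (hmul _ _).2, inv_mul_cancel, hone.2]⟩
      map_one' := Units.ext hone.2
      map_mul' := fun g h ↦ Units.ext (hmul g h).2 }
  refine ⟨m, p, hmn, hpn, finSumFinEquiv.trans (finCongr hmp), A, D, fun g ↦ ?_, fun g hg ↦ ?_,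
    fun g hg ↦ ?_⟩
  · rw [← hM_charpoly, hblock, Matrix.charpoly_fromBlocks_zero₂₁]
    rfl
  · rw [MonoidHom.mem_ker] at hg ⊢
    exact Units.ext (hker g hg).1
  · rw [MonoidHom.mem_ker] at hg ⊢
    exact Units.ext (hker g hg).2

/-! ### The semisimplification -/

/-- A representation of `G` on `kⁿ` which is **not semisimple has a proper non-zero
subrepresentation** (otherwise the lattice of subrepresentations is trivial or simple, hence
complemented). [folklore] -/
theorem exists_ne_bot_ne_top_of_not_isSemisimpleRepresentation {V : Type*} [AddCommGroup V]
    [Module k V] (ρ : Representation k G V) (h : ¬ ρ.IsSemisimpleRepresentation) :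
    ∃ W : Subrepresentation ρ, W ≠ ⊥ ∧ W ≠ ⊤ := by
  by_contra hcon
  push Not at hcon
  apply h
  by_cases hbt : (⊥ : Subrepresentation ρ) = ⊤
  · -- trivial lattice
    haveI : Subsingleton (Subrepresentation ρ) := subsingleton_of_bot_eq_top hbt
    exact ⟨fun W ↦ ⟨⊤, by rw [Subsingleton.elim W ⊥]; exact isCompl_bot_top⟩⟩
  · haveI : Nontrivial (Subrepresentation ρ) := ⟨⟨⊥, ⊤, hbt⟩⟩
    haveI : IsSimpleOrder (Subrepresentation ρ) := ⟨fun W ↦ or_iff_not_imp_left.mpr (hcon W)⟩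
    exact (inferInstance : ComplementedLattice (Subrepresentation ρ))

/-- **Semisimplification in every rank** (Curtis–Reiner I §16B; Bourbaki A VIII § 20 n° 6;
Deligne–Serre 1974, 6.12; Darmon–Diamond–Taylor 1995, §2.1).  For every homomorphism
`ψ : G → GL_n(k)` over a field `k` there is `ψ' : G → GL_n(k)` whose representation on `kⁿ` is
semisimple, with the same characteristic polynomials `det(X - ψ'(g)) = det(X - ψ(g))`, and with
`ker ψ ≤ ker ψ'`.  Proof by strong induction on `n`: if `kⁿ` is not already semisimple, dévissage
(`exists_blocks_of_subrepresentation`) along a proper non-zero stable subspace gives diagonal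
blocks `A`, `D` of smaller ranks with `charpoly ψ = charpoly A · charpoly D`, and the
block-diagonal sum (`exists_blockDiag_hom`) of semisimplifications of `A` and `D` is semisimple
(`isSemisimpleRepresentation_of_blockDiag`) with the required characteristic polynomials and
kernel. [cite: DeligneSerreASENS1974, 6.12] -/
theorem exists_semisimplification {n : ℕ} (ψ : G →* GL (Fin n) k) :
    ∃ ψ' : G →* GL (Fin n) k,
      Representation.IsSemisimpleRepresentation
        ((Representation.ofDistribMulAction k (GL (Fin n) k) (Fin n → k)).comp ψ') ∧
      (∀ g, ((ψ' g : GL (Fin n) k) : Matrix (Fin n) (Fin n) k).charpoly =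
        ((ψ g : GL (Fin n) k) : Matrix (Fin n) (Fin n) k).charpoly) ∧
      ψ.ker ≤ ψ'.ker := by
  induction n using Nat.strong_induction_on with
  | _ n ih =>
    classical
    by_cases hss : Representation.IsSemisimpleRepresentation
        ((Representation.ofDistribMulAction k (GL (Fin n) k) (Fin n → k)).comp ψ)
    · exact ⟨ψ, hss, fun _ ↦ rfl, le_rfl⟩
    obtain ⟨W, hW0, hW1⟩ := exists_ne_bot_ne_top_of_not_isSemisimpleRepresentation _ hss
    obtain ⟨m, p, hmn, hpn, e, A, D, hcp, hkerA, hkerD⟩ :=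
      exists_blocks_of_subrepresentation ψ W hW0 hW1
    obtain ⟨A', hA'ss, hA'cp, hA'ker⟩ := ih m hmn A
    obtain ⟨D', hD'ss, hD'cp, hD'ker⟩ := ih p hpn D
    obtain ⟨ψ', hψ'⟩ := exists_blockDiag_hom (k := k) e A' D'
    refine ⟨ψ', isSemisimpleRepresentation_of_blockDiag e hψ' hA'ss hD'ss, fun g ↦ ?_, fun g hg ↦ ?_⟩
    · rw [hψ' g, Matrix.charpoly_reindex, Matrix.charpoly_fromBlocks_zero₂₁, hA'cp, hD'cp, hcp]
    · have hA1 : A' g = 1 := hA'ker (hkerA hg)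
      have hD1 : D' g = 1 := hD'ker (hkerD hg)
      rw [MonoidHom.mem_ker]
      refine Units.ext ?_
      rw [hψ' g, hA1, hD1, Units.val_one, Units.val_one, Matrix.fromBlocks_one, Units.val_one,
        Matrix.reindex_apply, Matrix.submatrix_one_equiv]

end Literature.RepresentationTheory.Semisimple
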